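import Literature.MathematicalPhysics.QuantumFieldTheory.Balaban1983to89.B7Prop1Local
import HarnessLib

/-!
# T⁴ programme, node NE3 — the kinematic refinement lemma, leaf R1a+R1b (row NE3-S4c), file 1:
# BLOCK COORDINATES OF THE REFINED LATTICE (coarse site, in-block offset, transverse support of a fine bond)

Cell `pub-balaban`, NE3 (node U1b) formalisation swarm `b2b-balaban-t4-ne3-formalise-*`, unit
`b2b-balaban-t4-ne3-formalise-leaf-01` (LEAF PROVER 01), row **S4c** of `t4/formal/NE3/LEAVES.md` = leaf R1a+R1b of the
OWNER skeleton `t4/b2b-balaban-t4-ne3-p1/SKELETON-NE3-P1.md` v1.1 §3 («non-abelian 1-skeleton with pre-compensated chain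
targets + 2-cell even filling» of the KINEMATIC lemma `MinimalActionRefine.SmoothRefine`).

WHAT THIS FILE IS.  Pure lattice arithmetic on `ℤ^d` for a block size `L ≥ 1`, used by file 2 (`SkeletonFill`): the
coarse site `cdiv L x = ⌊x/L⌋` and the in-block offset `cmod L x = x mod L ∈ [0, L)^d` of a fine site (Euclidean division,
componentwise), uniqueness of the decomposition `x = L•z + q`, the TRANSVERSE SUPPORT `tset L x μ` of a fine bond
`⟨x, x + e_μ⟩` (directions `ν ≠ μ` with `q_ν ≠ 0`: empty on a coarse line, a singleton inside a coarse 2-cell), the offsets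
`off2 κ ν s t = s e_κ + t e_ν` of the sites met by the unit plaquettes of a coarse 2-cell with their stepping ∕ carrying
identities, and invariance under shifts by `L·P` (periodicity transport).  Conventions are the tree's: `B7Prop1Explicit.Site`,
`e`, words and `hol` (B7 = [Balaban1985Averaging] (9) p. 18), the chain end of a coarse bond is its LAST fine bond
`⟨Lz + (L−1)e_κ, Lz + Le_κ⟩` (= `AveragingDeficitFaceWords.faceSite` of row NE3-R2).

HONEST FRAMING.  Bookkeeping only; no estimate, no minimiser, no conditional of the cell (`BetaPertH`, (B), (B^μ)); nothing
bears on infinite volume, a mass gap, or the Clay problem; NE3 is NOT proved and this file instantiates no leaf of NE3 on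
Bałaban's minimisers.  Finite T⁴ rung (B)+1 of the cell's ladder.  No printed sentence is a hypothesis of any declaration;
no `sorry`, axioms ⊆ {propext, Classical.choice, Quot.sound}.  PLACEMENT (human rule 2026-08-19): cell work under
`Summits/QuantumFields/BalabanUV/`; imports the tree's `B7Prop1Local` (Literature) and `HarnessLib` only.
-/

set_option autoImplicit false

namespace Summit.QuantumFields.BalabanUV.T4Continuum.SkeletonLattice

open Literature.MathematicalPhysics.QuantumFieldTheory.Balaban1983to89
open B7Prop1Explicit
open Finset

variable {d : ℕ}

/-! ## §1 Coarse coordinates and in-block offsets of a fine site -/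

section Lattice

variable (L : ℕ)

/-- The coarse site `z = ⌊x / L⌋` (componentwise Euclidean quotient) of the block containing the fine site `x`. [folklore] -/
def cdiv (x : Site d) : Site d := fun i => x i / (L : ℤ)

/-- The in-block offset `q = x mod L ∈ [0, L)^d` of the fine site `x` (componentwise Euclidean remainder). [folklore] -/
def cmod (x : Site d) : Site d := fun i => x i % (L : ℤ)

/-- `x = L • ⌊x/L⌋ + (x mod L)`. [folklore] -/
theorem smul_cdiv_add_cmod (x : Site d) : (L : ℤ) • cdiv L x + cmod L x = x := by
  funext i
  simp only [cdiv, cmod, Pi.add_apply, Pi.smul_apply, smul_eq_mul]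
  rw [add_comm]; exact Int.emod_add_mul_ediv (x i) L

variable {L}

/-- Offsets are non-negative. [folklore] -/
theorem cmod_nonneg (hL : 1 ≤ L) (x : Site d) (i : Fin d) : 0 ≤ cmod L x i :=
  Int.emod_nonneg _ (by exact_mod_cast (by omega : L ≠ 0))

/-- Offsets are `< L`. [folklore] -/
theorem cmod_lt (hL : 1 ≤ L) (x : Site d) (i : Fin d) : cmod L x i < L :=
  Int.emod_lt_of_pos _ (by exact_mod_cast (by omega : 0 < L))

/-- Uniqueness of the block decomposition: if `x = L • z + q` with `q ∈ [0, L)^d` then `⌊x/L⌋ = z`. [folklore] -/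
theorem cdiv_eq_of_repr {x z q : Site d} (hx : x = (L : ℤ) • z + q) (hq0 : ∀ i, 0 ≤ q i) (hqL : ∀ i, q i < L) :
    cdiv L x = z := by
  funext i
  simp only [cdiv, hx, Pi.add_apply, Pi.smul_apply, smul_eq_mul]
  have hL0 : (L : ℤ) ≠ 0 := by
    have := hqL i; have := hq0 i; omega
  rw [show (L : ℤ) * z i + q i = q i + (L : ℤ) * z i by ring, Int.add_mul_ediv_left _ _ hL0,
    Int.ediv_eq_zero_of_lt (hq0 i) (hqL i), zero_add]

/-- Uniqueness of the block decomposition: if `x = L • z + q` with `q ∈ [0, L)^d` then `x mod L = q`. [folklore] -/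
theorem cmod_eq_of_repr {x z q : Site d} (hx : x = (L : ℤ) • z + q) (hq0 : ∀ i, 0 ≤ q i) (hqL : ∀ i, q i < L) :
    cmod L x = q := by
  funext i
  simp only [cmod, hx, Pi.add_apply, Pi.smul_apply, smul_eq_mul]
  rw [show (L : ℤ) * z i + q i = q i + (L : ℤ) * z i by ring, Int.add_mul_emod_self_left,
    Int.emod_eq_of_lt (hq0 i) (hqL i)]

end Lattice

/-! ## §2 The transverse support of a fine bond and the 2-skeleton -/

section Skeleton

variable (L : ℕ)

/-- The set of directions TRANSVERSE to the fine bond `⟨x, x + e_μ⟩` in which its in-block offset is non-zero.  The bond lies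
on a coarse line iff this set is empty, and in the interior of a coarse 2-cell iff it is a singleton. [folklore] -/
def tset (x : Site d) (μ : Fin d) : Finset (Fin d) := univ.filter fun ν => ν ≠ μ ∧ cmod L x ν ≠ 0

variable {L}

/-- Membership in the transverse support. [folklore] -/
theorem mem_tset {x : Site d} {μ ν : Fin d} : ν ∈ tset L x μ ↔ ν ≠ μ ∧ cmod L x ν ≠ 0 := by
  simp [tset]

/-- If every transverse offset other than (possibly) the one in direction `ν` vanishes, the transverse support is `∅` or
`{ν}`. [folklore] -/
theorem tset_subset_singleton {x : Site d} {μ ν : Fin d} (h0 : ∀ i, i ≠ μ → i ≠ ν → cmod L x i = 0) :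
    tset L x μ ⊆ {ν} := by
  intro i hi
  rw [mem_tset] at hi
  rw [mem_singleton]
  by_contra hne
  exact hi.2 (h0 i hi.1 hne)

end Skeleton

/-! ## §3 Offsets of the sites met by a 2-cell plaquette -/

section Offsets

variable {L : ℕ}

/-- The offset `s e_κ + t e_ν`. [folklore] -/
def off2 (κ ν : Fin d) (s t : ℕ) : Site d := (s : ℤ) • e κ + (t : ℤ) • e ν

/-- Components of `s e_κ + t e_ν`. [folklore] -/
theorem off2_apply (κ ν : Fin d) (s t : ℕ) (i : Fin d) :
    off2 κ ν s t i = (if i = κ then (s : ℤ) else 0) + (if i = ν then (t : ℤ) else 0) := by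
  simp [off2, e_apply]

/-- `(s e_κ + t e_ν)_κ = s` for `κ ≠ ν`. [folklore] -/
theorem off2_apply_left {κ ν : Fin d} (hκν : κ ≠ ν) (s t : ℕ) : off2 κ ν s t κ = s := by
  rw [off2_apply]; simp [hκν]

/-- `(s e_κ + t e_ν)_ν = t` for `κ ≠ ν`. [folklore] -/
theorem off2_apply_right {κ ν : Fin d} (hκν : κ ≠ ν) (s t : ℕ) : off2 κ ν s t ν = t := by
  rw [off2_apply]; simp [hκν.symm]

/-- `(s e_κ + t e_ν)_i = 0` off `κ, ν`. [folklore] -/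
theorem off2_apply_other {κ ν i : Fin d} (hiκ : i ≠ κ) (hiν : i ≠ ν) (s t : ℕ) : off2 κ ν s t i = 0 := by
  rw [off2_apply]; simp [hiκ, hiν]

/-- `s e_κ + t e_ν ∈ [0, L)^d` for `s, t < L`, `κ ≠ ν`: lower bound. [folklore] -/
theorem off2_nonneg (κ ν : Fin d) (s t : ℕ) (i : Fin d) : 0 ≤ off2 κ ν s t i := by
  rw [off2_apply]; split_ifs <;> positivity

/-- `s e_κ + t e_ν ∈ [0, L)^d` for `s, t < L`, `κ ≠ ν`: upper bound. [folklore] -/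
theorem off2_lt {κ ν : Fin d} (hκν : κ ≠ ν) {s t : ℕ} (hs : s < L) (ht : t < L) (i : Fin d) :
    off2 κ ν s t i < L := by
  rw [off2_apply]
  by_cases hi : i = κ
  · subst hi; simp [hκν]; exact_mod_cast hs
  · by_cases hj : i = ν
    · subst hj; simp [hi]; exact_mod_cast ht
    · simp [hi, hj]; exact_mod_cast (by omega : 0 < L)

/-- Coarse coordinate of `L z + s e_κ + t e_ν`. [folklore] -/
theorem cdiv_off2 {κ ν : Fin d} (hκν : κ ≠ ν) (z : Site d) {s t : ℕ} (hs : s < L) (ht : t < L) :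
    cdiv L ((L : ℤ) • z + off2 κ ν s t) = z :=
  cdiv_eq_of_repr rfl (off2_nonneg κ ν s t) (off2_lt hκν hs ht)

/-- Offsets of `L z + s e_κ + t e_ν`. [folklore] -/
theorem cmod_off2 {κ ν : Fin d} (hκν : κ ≠ ν) (z : Site d) {s t : ℕ} (hs : s < L) (ht : t < L) :
    cmod L ((L : ℤ) • z + off2 κ ν s t) = off2 κ ν s t :=
  cmod_eq_of_repr rfl (off2_nonneg κ ν s t) (off2_lt hκν hs ht)

/-- `s e_κ + 0 e_ν = s e_κ`. [folklore] -/
theorem off2_zero_right (κ ν : Fin d) (s : ℕ) : off2 κ ν s 0 = (s : ℤ) • e κ := by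
  simp [off2]

/-- `0 e_κ + t e_ν = t e_ν`. [folklore] -/
theorem off2_zero_left (κ ν : Fin d) (t : ℕ) : off2 κ ν 0 t = (t : ℤ) • e ν := by
  simp [off2]

/-- `off2` is symmetric under exchanging the two (direction, count) pairs. [folklore] -/
theorem off2_comm (κ ν : Fin d) (s t : ℕ) : off2 κ ν s t = off2 ν κ t s := by
  simp only [off2]; abel

/-- Stepping in `κ`: `(s e_κ + t e_ν) + e_κ = (s+1) e_κ + t e_ν`. [folklore] -/
theorem off2_add_e_left (κ ν : Fin d) (s t : ℕ) : off2 κ ν s t + e κ = off2 κ ν (s + 1) t := by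
  simp only [off2, Nat.cast_succ, add_smul, one_smul]; abel

/-- Stepping in `ν`: `(s e_κ + t e_ν) + e_ν = s e_κ + (t+1) e_ν`. [folklore] -/
theorem off2_add_e_right (κ ν : Fin d) (s t : ℕ) : off2 κ ν s t + e ν = off2 κ ν s (t + 1) := by
  simp only [off2, Nat.cast_succ, add_smul, one_smul]; abel

/-- Carrying in `κ`: `L z + (L−1+1) e_κ + t e_ν = L (z + e_κ) + 0 e_κ + t e_ν`. [folklore] -/
theorem carry_left (hL : 1 ≤ L) (κ ν : Fin d) (z : Site d) (t : ℕ) :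
    (L : ℤ) • z + off2 κ ν (L - 1 + 1) t = (L : ℤ) • (z + e κ) + off2 κ ν 0 t := by
  simp only [off2, Nat.sub_add_cancel hL, Nat.cast_zero, zero_smul, zero_add, smul_add]
  abel

/-- Carrying in `ν`: `L z + s e_κ + (L−1+1) e_ν = L (z + e_ν) + s e_κ + 0 e_ν`. [folklore] -/
theorem carry_right (hL : 1 ≤ L) (κ ν : Fin d) (z : Site d) (s : ℕ) :
    (L : ℤ) • z + off2 κ ν s (L - 1 + 1) = (L : ℤ) • (z + e ν) + off2 κ ν s 0 := by
  simp only [off2, Nat.sub_add_cancel hL, Nat.cast_zero, zero_smul, add_zero, smul_add]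
  abel

/-- For `s < L`: `(s : ℤ) = L − 1 ↔ s = L − 1`. [folklore] -/
theorem natCast_eq_sub_one_iff (hL : 1 ≤ L) {s : ℕ} : ((s : ℤ) = (L : ℤ) - 1) ↔ s = L - 1 := by
  omega

end Offsets

/-! ## §4 Shifts by whole periods -/

section Period

variable {L : ℕ}

/-- Coarse coordinates under a shift by `L·P` lattice units in direction `κ`. [folklore] -/
theorem cdiv_add_period (hL : 1 ≤ L) (P : ℤ) (x : Site d) (κ : Fin d) :
    cdiv L (x + ((L : ℤ) * P) • e κ) = cdiv L x + P • e κ := by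
  funext i
  have hL0 : (L : ℤ) ≠ 0 := by exact_mod_cast (by omega : L ≠ 0)
  simp only [cdiv, Pi.add_apply, Pi.smul_apply, e_apply, smul_eq_mul]
  split_ifs
  · rw [mul_one, mul_comm (L : ℤ) P, Int.add_mul_ediv_right _ _ hL0, mul_one]
  · simp

/-- Offsets are invariant under a shift by `L·P` lattice units. [folklore] -/
theorem cmod_add_period (P : ℤ) (x : Site d) (κ : Fin d) :
    cmod L (x + ((L : ℤ) * P) • e κ) = cmod L x := by
  funext i
  simp only [cmod, Pi.add_apply, Pi.smul_apply, e_apply, smul_eq_mul]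
  split_ifs
  · rw [mul_one, mul_comm (L : ℤ) P, Int.add_mul_emod_self_right]
  · simp

/-- The transverse support is invariant under a shift by `L·P` lattice units. [folklore] -/
theorem tset_add_period (P : ℤ) (x : Site d) (κ μ : Fin d) :
    tset L (x + ((L : ℤ) * P) • e κ) μ = tset L x μ := by
  simp only [tset, cmod_add_period]

end Period

end Summit.QuantumFields.BalabanUV.T4Continuum.SkeletonLattice
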